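import Mathlib
import Literature.NumberTheory.LFunctions.Zhang2022.Section13MeanSquaresParams
import HarnessLib

/-!
# Zhang (2022) §13 p. 75, (13.11): "Cauchy's inequality" on the positive weights, and the reduction of
# the `E₁(ρ+β_j,ψ)`-terms of `𝓔` to quadratic zero-sums of the `E₁`-polynomial (Fubini + Cauchy in `v`)

Topic `Literature/NumberTheory/LFunctions/Zhang2022` (Landau–Siegel audit tree; verdict-neutral).
Y. Zhang, *Discrete mean estimates and the Landau–Siegel zero*, arXiv:2211.02515v1 (2022)
[Zhang2022LandauSiegel], §13 p. 75 (tex L3806–3817): "Combining (2.34), **Cauchy's inequality**,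
Proposition 7.1, Lemma 5.9, 6.1 and 3.3, we can verify that `𝓔 = o(𝔓)` (13.11)" — NOT carried out in
print (plan/GAP-LEDGER G-L3t6-3; lane ZHANG-L WP14, leaf `Skeleton.Eq1311Rel c′ c₀`, item I3-D).
**An unrefereed manuscript under adjudication; nothing here asserts its Theorems 1–2.**

`𝓔 = ΣΣ_{(ψ,ρ)} E₁*(ρ,ψ)|B(ρ,ψ)||ω(ρ)|` (display after (13.10)) is a sum over the finite index set
`idx χ` of products `w·a·b` with the POSITIVE weight `w = |L(ρ+β₁,ψ)/L′(ρ,ψ)|·|ω(ρ)|`; two of its five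
summands carry Lemma 6.1's error `E₁(ρ+β_j,ψ) = 𝓛⁻⁶⁸∫_{−𝓛²⁰}^{𝓛²⁰}|Σ_{n<T³}ψ(n)n^{−(ρ+β_j+iv)}|e^{−v²/4𝓛³⁰}dv`
(+ `e^{−c₀𝓛¹⁰}`), the tree's `Skeleton.E1main`. This file gives the two generic inequalities the
assembly of (13.11) uses for every summand:

* `weighted_cauchy_schwarz` — `Σ_i w_i a_i b_i ≤ √(Σ_i w_i a_i²)·√(Σ_i w_i b_i²)` (`w, a, b ≥ 0`), stated
  against upper bounds `QA`, `QB` of the two quadratic sums;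
* `integral_E1weight_le` — the Gaussian mass `∫_{−L}^{L} e^{−v²/(4𝓛³⁰)}dv ≤ 2√π·𝓛¹⁵`;
* `weighted_sum_E1main_le` — **the `E₁`-reduction**:
  `Σ_i w_i a_i b_i E₁main(x_i)(z_i) ≤ 𝓛⁻⁶⁸·2√π𝓛¹⁵·√QA·√QB`, where `QA ≥ Σ_i w_i a_i²` and `QB` bounds,
  UNIFORMLY in `|v| ≤ 𝓛²⁰`, the quadratic sum `Σ_i w_i (b_i·|Σ_{n<T³}ψ_i(n)n^{−(z_i+iv)}|)²` (the finite
  sum is taken inside the `v`-integral, Cauchy's inequality is applied pointwise in `v`, and the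
  Gaussian is integrated last — so `E₁` costs exactly `𝓛⁻⁶⁸·2√π𝓛¹⁵ = 2√π𝓛⁻⁵³` times the geometric mean
  of two zero-sums, the budget line of the lane's R-1).

Elementary (finite sums, interval integrals of continuous functions); no definitions, no new facts.
WHAT THIS IS NOT: any claim about Theorems 1–2 of the manuscript or about Landau–Siegel zeros.

## References

* Y. Zhang, arXiv:2211.02515v1 (2022), §13 p. 75; §6 Lemma 6.1 p. 30 (the error `E₁`).
  [cite: Zhang2022LandauSiegel, §13 (13.11) p.75]
-/

noncomputable section

open Complex Real Finset MeasureTheory intervalIntegral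

namespace Literature.NumberTheory.LFunctions.Zhang2022.Typed.Section13

open Skeleton

/-- **"Cauchy's inequality" with non-negative weights**: if `w, a, b ≥ 0` on `s`,
`Σ_{i∈s} w_i a_i² ≤ Q_A` and `Σ_{i∈s} w_i b_i² ≤ Q_B`, then `Σ_{i∈s} w_i a_i b_i ≤ √Q_A·√Q_B`.
[cite: Zhang2022LandauSiegel, §13 p.75 ("Cauchy's inequality")] -/
theorem weighted_cauchy_schwarz {ι : Type*} (s : Finset ι) {w a b : ι → ℝ}
    (hw : ∀ i ∈ s, 0 ≤ w i) (ha : ∀ i ∈ s, 0 ≤ a i) (hb : ∀ i ∈ s, 0 ≤ b i) {QA QB : ℝ}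
    (hQA : ∑ i ∈ s, w i * a i ^ 2 ≤ QA) (hQB : ∑ i ∈ s, w i * b i ^ 2 ≤ QB) :
    ∑ i ∈ s, w i * a i * b i ≤ Real.sqrt QA * Real.sqrt QB := by
  have hA0 : 0 ≤ ∑ i ∈ s, w i * a i ^ 2 :=
    Finset.sum_nonneg fun i hi => mul_nonneg (hw i hi) (sq_nonneg _)
  have hB0 : 0 ≤ ∑ i ∈ s, w i * b i ^ 2 :=
    Finset.sum_nonneg fun i hi => mul_nonneg (hw i hi) (sq_nonneg _)
  have hQA0 : 0 ≤ QA := hA0.trans hQA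
  have hS0 : 0 ≤ ∑ i ∈ s, w i * a i * b i :=
    Finset.sum_nonneg fun i hi => mul_nonneg (mul_nonneg (hw i hi) (ha i hi)) (hb i hi)
  have hcs : (∑ i ∈ s, w i * a i * b i) ^ 2 ≤
      (∑ i ∈ s, w i * a i ^ 2) * ∑ i ∈ s, w i * b i ^ 2 :=
    Finset.sum_sq_le_sum_mul_sum_of_sq_le_mul s
      (fun i hi => mul_nonneg (hw i hi) (sq_nonneg _))
      (fun i hi => mul_nonneg (hw i hi) (sq_nonneg _))
      (fun i _ => le_of_eq (by ring))
  have hsq : (∑ i ∈ s, w i * a i * b i) ^ 2 ≤ QA * QB :=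
    hcs.trans (mul_le_mul hQA hQB hB0 hQA0)
  rw [← Real.sqrt_mul hQA0]
  exact Real.le_sqrt_of_sq_le hsq

/-- **The Gaussian mass of `E₁`'s weight**: `∫_{−L}^{L} e^{−v²/(4𝓛³⁰)}dv ≤ 2√π·𝓛¹⁵` for `L ≥ 0`, `𝓛 > 0`
(the whole-line Gaussian integral `√(4π𝓛³⁰)`). [cite: Zhang2022LandauSiegel, §6 Lemma 6.1 p.30] -/
theorem integral_E1weight_le {D : ℕ} (hℓ : 0 < ell D) {L : ℝ} (hL : 0 ≤ L) :
    ∫ v in (-L)..L, Real.exp (-(v ^ 2) / (4 * ell D ^ 30)) ≤ 2 * Real.sqrt π * ell D ^ 15 := by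
  set b : ℝ := (4 * ell D ^ 30)⁻¹ with hb
  have hb0 : 0 < b := by positivity
  have hfun : (fun v : ℝ => Real.exp (-(v ^ 2) / (4 * ell D ^ 30))) =
      fun v : ℝ => Real.exp (-b * v ^ 2) := by
    funext v; congr 1; rw [hb]; field_simp
  rw [hfun]
  have hint : Integrable (fun v : ℝ => Real.exp (-b * v ^ 2)) := integrable_exp_neg_mul_sq hb0
  have hLL : -L ≤ L := by linarith
  calc ∫ v in (-L)..L, Real.exp (-b * v ^ 2)
      = ∫ v in Set.Ioc (-L) L, Real.exp (-b * v ^ 2) := intervalIntegral.integral_of_le hLL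
    _ ≤ ∫ v : ℝ, Real.exp (-b * v ^ 2) :=
        setIntegral_le_integral hint (Filter.Eventually.of_forall fun v => (Real.exp_pos _).le)
    _ = Real.sqrt (π / b) := integral_gaussian b
    _ = 2 * Real.sqrt π * ell D ^ 15 := by
        rw [hb, div_inv_eq_mul, show π * (4 * ell D ^ 30) = (2 * ell D ^ 15) ^ 2 * π by ring,
          Real.sqrt_mul (sq_nonneg _), Real.sqrt_sq (by positivity)]
        ring

/-- **The `E₁`-reduction** (item I3-D of the lane's (13.11) programme): for non-negative weights `w`,
factors `a, b ≥ 0` on a finite index set, points `z_i` and characters `ψ_i ∈ Ψ`, if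
`Σ_i w_i a_i² ≤ Q_A` and, for every `|v| ≤ 𝓛²⁰`, `Σ_i w_i (b_i·|Σ_{n<T³}ψ_i(n)n^{−(z_i+iv)}|)² ≤ Q_B`, then
`Σ_i w_i a_i b_i E₁main(ψ_i)(z_i) ≤ 𝓛⁻⁶⁸·(2√π𝓛¹⁵)·√Q_A·√Q_B` — the finite sum goes inside the
`v`-integral of `E₁main = 𝓛⁻⁶⁸∫_{−𝓛²⁰}^{𝓛²⁰}|Σ_{n<T³}ψ(n)n^{−(z+iv)}|e^{−v²/4𝓛³⁰}dv`, Cauchy's inequality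
is applied pointwise in `v`, and the Gaussian is integrated last. [cite: Zhang2022LandauSiegel, §13 p.75; §6 Lemma 6.1] -/
theorem weighted_sum_E1main_le {ι : Type*} (s : Finset ι) {D : ℕ} (hℓ : 0 < ell D)
    (x : ι → Chr D) (z : ι → ℂ) {w a b : ι → ℝ}
    (hw : ∀ i ∈ s, 0 ≤ w i) (ha : ∀ i ∈ s, 0 ≤ a i) (hb : ∀ i ∈ s, 0 ≤ b i) {QA QB : ℝ}
    (hQA : ∑ i ∈ s, w i * a i ^ 2 ≤ QA)
    (hQB : ∀ v : ℝ, |v| ≤ ell D ^ 20 →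
      ∑ i ∈ s, w i * (b i * ‖∑ n ∈ Finset.Ico 1 ⌈bigT D ^ 3⌉₊,
        (x i).ψ (n : ZMod (x i).p) * (n : ℂ) ^ (-(z i + v * I))‖) ^ 2 ≤ QB) :
    ∑ i ∈ s, w i * a i * b i * E1main (x i) (z i) ≤
      (ell D ^ 68)⁻¹ * (2 * Real.sqrt π * ell D ^ 15) * (Real.sqrt QA * Real.sqrt QB) := by
  set Lw : ℝ := ell D ^ 20 with hLw
  have hLw0 : 0 ≤ Lw := by positivity
  have hLL : -Lw ≤ Lw := by linarith
  -- the integrand of `E₁main` and the Gaussian weight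
  set F : ι → ℝ → ℝ := fun i v =>
    ‖∑ n ∈ Finset.Ico 1 ⌈bigT D ^ 3⌉₊, (x i).ψ (n : ZMod (x i).p) * (n : ℂ) ^ (-(z i + v * I))‖ with hF
  set wt : ℝ → ℝ := fun v => Real.exp (-(v ^ 2) / (4 * ell D ^ 30)) with hwt
  have hFc : ∀ i, Continuous (F i) := fun i => continuous_norm_dirPoly_shift (x i) (z i) _
  have hwtc : Continuous wt := by
    rw [hwt]; exact Real.continuous_exp.comp (by fun_prop)
  have hwt0 : ∀ v, 0 ≤ wt v := fun v => (Real.exp_pos _).le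
  have hF0 : ∀ i v, 0 ≤ F i v := fun i v => norm_nonneg _
  have hE : ∀ i, E1main (x i) (z i) = (ell D ^ 68)⁻¹ * ∫ v in (-Lw)..Lw, F i v * wt v := fun i => rfl
  -- pointwise in `v`: Cauchy's inequality
  have hpt : ∀ v ∈ Set.Icc (-Lw) Lw,
      ∑ i ∈ s, w i * a i * b i * (F i v * wt v) ≤ Real.sqrt QA * Real.sqrt QB * wt v := by
    intro v hv
    have hvabs : |v| ≤ ell D ^ 20 := abs_le.mpr ⟨hv.1, hv.2⟩
    have hcs := weighted_cauchy_schwarz s hw ha (fun i hi => mul_nonneg (hb i hi) (hF0 i v)) hQA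
      (hQB v hvabs)
    have heq : ∑ i ∈ s, w i * a i * b i * (F i v * wt v) =
        (∑ i ∈ s, w i * a i * (b i * F i v)) * wt v := by
      rw [Finset.sum_mul]; exact Finset.sum_congr rfl fun i _ => by ring
    rw [heq]
    exact mul_le_mul_of_nonneg_right hcs (hwt0 v)
  -- integrate
  have hint_i : ∀ i ∈ s, IntervalIntegrable (fun v => w i * a i * b i * (F i v * wt v)) volume (-Lw) Lw :=
    fun i _ => (continuous_const.mul ((hFc i).mul hwtc)).intervalIntegrable _ _
  have hsum_int : IntervalIntegrable (fun v => ∑ i ∈ s, w i * a i * b i * (F i v * wt v)) volume (-Lw) Lw :=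
    (continuous_finsetSum s fun i _ => continuous_const.mul ((hFc i).mul hwtc)).intervalIntegrable _ _
  have hQ0 : 0 ≤ Real.sqrt QA * Real.sqrt QB := mul_nonneg (Real.sqrt_nonneg _) (Real.sqrt_nonneg _)
  calc ∑ i ∈ s, w i * a i * b i * E1main (x i) (z i)
      = ∑ i ∈ s, (ell D ^ 68)⁻¹ * ∫ v in (-Lw)..Lw, w i * a i * b i * (F i v * wt v) := by
        refine Finset.sum_congr rfl fun i _ => ?_
        rw [hE i, intervalIntegral.integral_const_mul]; ring
    _ = (ell D ^ 68)⁻¹ * ∫ v in (-Lw)..Lw, ∑ i ∈ s, w i * a i * b i * (F i v * wt v) := by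
        rw [← Finset.mul_sum, intervalIntegral.integral_finsetSum hint_i]
    _ ≤ (ell D ^ 68)⁻¹ * ∫ v in (-Lw)..Lw, Real.sqrt QA * Real.sqrt QB * wt v := by
        refine mul_le_mul_of_nonneg_left ?_ (by positivity)
        exact intervalIntegral.integral_mono_on hLL hsum_int
          ((continuous_const.mul hwtc).intervalIntegrable _ _) hpt
    _ = (ell D ^ 68)⁻¹ * ((Real.sqrt QA * Real.sqrt QB) * ∫ v in (-Lw)..Lw, wt v) := by
        rw [intervalIntegral.integral_const_mul]
    _ ≤ (ell D ^ 68)⁻¹ * ((Real.sqrt QA * Real.sqrt QB) * (2 * Real.sqrt π * ell D ^ 15)) := by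
        refine mul_le_mul_of_nonneg_left (mul_le_mul_of_nonneg_left ?_ hQ0) (by positivity)
        exact integral_E1weight_le hℓ hLw0
    _ = _ := by ring

end Literature.NumberTheory.LFunctions.Zhang2022.Typed.Section13
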